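import Summits.ABC.ABC.Theorems.TwistAmplificationSharpModerateLawCuspCoordinates

/-!
# Crux `TwistAmplification.SharpModerateLaw` (stmt-ABC-1975), line `syzygy-lattice-half-deep-few-primes`:
the transfer stub `stub_cuspTransfer : CuspTransfer` (`CuspShellLaw → SharpModerateLaw`)

The crux counts reduced global minimal integral Weierstrass models `W₀` with `c₄c₆ ≠ 0`, conductor
`N ≤ X` and `N^κ ≤ M⁺ := max(|Δ|, |c₄|³) ≤ N^σ`.  This file proves that the dyadic CUSP SHELL LAW
(`CuspShellLaw`: `#cuspShell(X,Y) ≤ C_ε (XY)^ε (X·Y^{-1/6} + 1)` for the pairs `(c₄,c₆)` with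
`c₄c₆ ≠ 0`, `c₄³ ≠ c₆²`, `1728 ∣ c₄³ − c₆²`, tower-free, `Y ≤ M⁺ < 2Y`, conductor proxy `N5cusp ≤ X`)
implies the crux (registered stub `stub_cuspTransfer` of the line's skeleton):
* `W₀ ↦ (c₄, c₆)` maps the window into `⋃_{j ≤ J} cuspShell X_j 2^j`, `X_j = min(X, 2^{(j+1)/κ})`,
  `2^J ≤ X^σ` (file `…CuspCoordinates`), and the fibres of `W₀ ↦ (a₁, a₂, a₃, c₄, c₆)` are points with
  `(a₁,a₂,a₃)` in a set of `12` triples;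
* uniformly in `j`, `X_j (2^j)^{-1/6} ≤ 2 X^{1−κ/6}` (`shell_main_le`; this is where `κ ≤ 6` enters),
  and the `J + 1 ≪ σ log X` shells and the `(X_jY_j)^{ε'} ≤ X^{(1+σ)ε'}` losses are absorbed into `X^ε`
  (`ε' = ε/(2(σ+1))`).
-/

noncomputable section

namespace Summit.ABC.ABC.Theorems.SharpModerateLaw

open WeierstrassCurve IsDedekindDomain Rat.HeightOneSpectrum Real

/-! ## 4. The uniform analytic bound on one shell, and the assembly -/

section Analysis

/-- Uniformly in `j`: `min(X, 2^{(j+1)/κ}) · (2^j)^{-1/6} ≤ 2 · X^{1−κ/6}` for `0 < κ ≤ 6`, `X ≥ 1`. -/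
theorem shell_main_le {κ X : ℝ} (hκ0 : 0 < κ) (hκ6 : κ ≤ 6) (hX : 1 ≤ X) (j : ℕ) :
    min X ((2 : ℝ) ^ (((j + 1 : ℕ) : ℝ) / κ)) * ((2 : ℝ) ^ j) ^ (-(1 / 6 : ℝ)) ≤ 2 * X ^ (1 - κ / 6) := by
  have hX0 : 0 < X := by linarith
  set A : ℝ := (2 : ℝ) ^ (((j + 1 : ℕ) : ℝ)) with hA
  have hA0 : 0 < A := Real.rpow_pos_of_pos (by norm_num) _
  have hu : (2 : ℝ) ^ j = A / 2 := by
    rw [hA, Real.rpow_natCast, pow_succ]; ring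
  have h216 : (2 : ℝ) ^ (1 / 6 : ℝ) ≤ 2 := by
    calc (2 : ℝ) ^ (1 / 6 : ℝ) ≤ (2 : ℝ) ^ (1 : ℝ) :=
          Real.rpow_le_rpow_of_exponent_le (by norm_num) (by norm_num)
      _ = 2 := Real.rpow_one 2
  have hXκ0 : 0 < X ^ κ := Real.rpow_pos_of_pos hX0 κ
  -- `(A/2)^{-1/6} = A^{-1/6} · 2^{1/6}`
  have hsplit : (A / 2) ^ (-(1 / 6 : ℝ)) = A ^ (-(1 / 6 : ℝ)) * (2 : ℝ) ^ (1 / 6 : ℝ) := by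
    rw [Real.div_rpow hA0.le (by norm_num), Real.rpow_neg (by norm_num : (0:ℝ) ≤ 2), div_inv_eq_mul]
  rw [hu, hsplit]
  rcases le_or_gt A (X ^ κ) with hAX | hAX
  · -- Case `A ≤ X^κ`: use the second term of the `min`
    have hmin : min X ((2 : ℝ) ^ (((j + 1 : ℕ) : ℝ) / κ)) ≤ A ^ (1 / κ) := by
      rw [div_eq_mul_one_div, Real.rpow_mul (by norm_num)]
      exact min_le_right _ _
    have hexp : 0 ≤ 1 / κ - 1 / 6 := by
      rw [sub_nonneg]; exact one_div_le_one_div_of_le hκ0 hκ6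
    calc min X ((2 : ℝ) ^ (((j + 1 : ℕ) : ℝ) / κ)) * (A ^ (-(1 / 6 : ℝ)) * (2 : ℝ) ^ (1 / 6 : ℝ))
        ≤ A ^ (1 / κ) * (A ^ (-(1 / 6 : ℝ)) * (2 : ℝ) ^ (1 / 6 : ℝ)) :=
          mul_le_mul_of_nonneg_right hmin (by positivity)
      _ = (2 : ℝ) ^ (1 / 6 : ℝ) * A ^ (1 / κ - 1 / 6) := by
          rw [sub_eq_add_neg, Real.rpow_add hA0]; ring
      _ ≤ 2 * (X ^ κ) ^ (1 / κ - 1 / 6) := by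
          apply mul_le_mul h216 (Real.rpow_le_rpow hA0.le hAX hexp) (by positivity) (by norm_num)
      _ = 2 * X ^ (1 - κ / 6) := by
          rw [← Real.rpow_mul hX0.le]
          congr 2
          field_simp
  · -- Case `X^κ < A`: use the first term of the `min`
    have hmin : min X ((2 : ℝ) ^ (((j + 1 : ℕ) : ℝ) / κ)) ≤ X := min_le_left _ _
    have hanti : A ^ (-(1 / 6 : ℝ)) ≤ (X ^ κ) ^ (-(1 / 6 : ℝ)) := by
      rw [Real.rpow_neg hA0.le, Real.rpow_neg hXκ0.le]
      exact inv_anti₀ (Real.rpow_pos_of_pos hXκ0 _) (Real.rpow_le_rpow hXκ0.le hAX.le (by norm_num))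
    calc min X ((2 : ℝ) ^ (((j + 1 : ℕ) : ℝ) / κ)) * (A ^ (-(1 / 6 : ℝ)) * (2 : ℝ) ^ (1 / 6 : ℝ))
        ≤ X * ((X ^ κ) ^ (-(1 / 6 : ℝ)) * 2) := by
          apply mul_le_mul hmin _ (by positivity) hX0.le
          exact mul_le_mul hanti h216 (by positivity) (by positivity)
      _ = 2 * (X ^ (1 : ℝ) * X ^ (-(κ / 6))) := by
          rw [Real.rpow_one, ← Real.rpow_mul hX0.le]
          ring_nf
      _ = 2 * X ^ (1 - κ / 6) := by
          rw [← Real.rpow_add hX0, sub_eq_add_neg]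

end Analysis

/-! ## 5. The stub -/

section Assembly

/-- The twelve reduced coefficient triples `(a₁, a₂, a₃) ∈ {0,1} × {−1,0,1} × {0,1}`. -/
theorem card_reducedTriples :
    ((({0, 1} : Finset ℤ) ×ˢ (({-1, 0, 1} : Finset ℤ) ×ˢ ({0, 1} : Finset ℤ))).card) = 12 := by
  rfl

/-- The number of shells: `⌊log₂ ⌊X^σ⌋⌋ + 1 ≤ (2σ/(ε log 2) + 1) · X^{ε/2}` for `X ≥ 1`, `σ ≥ 0`, `ε > 0`. -/
theorem card_shells_le {σ ε X : ℝ} (hσ : 0 ≤ σ) (hε : 0 < ε) (hX : 1 ≤ X) :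
    ((Nat.log 2 ⌊X ^ σ⌋₊ + 1 : ℕ) : ℝ) ≤ (2 * σ / (ε * Real.log 2) + 1) * X ^ (ε / 2) := by
  have hX0 : 0 < X := by linarith
  have hXσ1 : 1 ≤ X ^ σ := Real.one_le_rpow hX hσ
  have hfl0 : ⌊X ^ σ⌋₊ ≠ 0 := by
    have : 1 ≤ ⌊X ^ σ⌋₊ := Nat.le_floor (by exact_mod_cast hXσ1)
    omega
  set J := Nat.log 2 ⌊X ^ σ⌋₊ with hJ
  have h2J : (2 : ℝ) ^ J ≤ X ^ σ := by
    have h1 : ((2 ^ J : ℕ) : ℝ) ≤ (⌊X ^ σ⌋₊ : ℝ) := by exact_mod_cast Nat.pow_log_le_self 2 hfl0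
    push_cast at h1
    exact h1.trans (Nat.floor_le (by positivity))
  have hlog2 : 0 < Real.log 2 := Real.log_pos (by norm_num)
  have hJle : (J : ℝ) * Real.log 2 ≤ σ * Real.log X := by
    have := Real.log_le_log (by positivity) h2J
    rwa [Real.log_pow, Real.log_rpow hX0] at this
  have hlogX : Real.log X ≤ X ^ (ε / 2) / (ε / 2) := Real.log_le_rpow_div hX0.le (by positivity)
  have hXe1 : 1 ≤ X ^ (ε / 2) := Real.one_le_rpow hX (by positivity)
  have hJ' : (J : ℝ) ≤ 2 * σ / (ε * Real.log 2) * X ^ (ε / 2) := by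
    rw [div_mul_eq_mul_div, le_div_iff₀ (by positivity)]
    calc (J : ℝ) * (ε * Real.log 2) = ε * ((J : ℝ) * Real.log 2) := by ring
      _ ≤ ε * (σ * Real.log X) := mul_le_mul_of_nonneg_left hJle hε.le
      _ ≤ ε * (σ * (X ^ (ε / 2) / (ε / 2))) :=
          mul_le_mul_of_nonneg_left (mul_le_mul_of_nonneg_left hlogX hσ) hε.le
      _ = 2 * σ * X ^ (ε / 2) := by field_simp
  push_cast
  nlinarith

/-- **`stub_cuspTransfer`**: the cusp shell law implies the crux `SharpModerateLaw`. -/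
theorem stub_cuspTransfer : CuspTransfer := by
  intro hlaw κ σ ε hκ3 hκ6 hσ6 hε
  have hκ0 : 0 < κ := by linarith
  have hσ0 : 0 ≤ σ := by linarith
  have hε' : 0 < ε / (2 * (σ + 1)) := by positivity
  obtain ⟨C, hC⟩ := hlaw (ε / (2 * (σ + 1))) hε'
  set C₀ : ℝ := max C 0 with hC₀
  have hC₀0 : 0 ≤ C₀ := le_max_right _ _
  refine ⟨12 * (3 * C₀) * (2 * σ / (ε * Real.log 2) + 1), fun X hX => ?_⟩
  have hX0 : 0 < X := by linarith
  -- the shells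
  set J : ℕ := Nat.log 2 ⌊X ^ σ⌋₊ with hJ
  set Xj : ℕ → ℝ := fun j => min X ((2 : ℝ) ^ (((j + 1 : ℕ) : ℝ) / κ)) with hXj
  set T : Finset (ℤ × ℤ × ℤ) := ({0, 1} : Finset ℤ) ×ˢ (({-1, 0, 1} : Finset ℤ) ×ˢ ({0, 1} : Finset ℤ))
    with hT
  set U : Set (ℤ × ℤ) := ⋃ j ∈ Finset.range (J + 1), cuspShell (Xj j) ((2 : ℝ) ^ j) with hU
  have hfin : ((↑T : Set (ℤ × ℤ × ℤ)) ×ˢ U).Finite :=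
    T.finite_toSet.prod (Set.Finite.biUnion (Finset.range (J + 1)).finite_toSet
      fun j _ => cuspShell_finite _ _)
  -- Step 1: the window maps injectively into `T × U`
  have hmaps : ∀ W : WeierstrassCurve ℤ, W ∈ {W₀ : WeierstrassCurve ℤ | (W₀.baseChange ℚ).IsElliptic ∧
      (∀ v : IsDedekindDomain.HeightOneSpectrum ℤ, (W₀.baseChange ℚ).IsMinimalAt v) ∧
      (W₀.a₁ = 0 ∨ W₀.a₁ = 1) ∧ (W₀.a₃ = 0 ∨ W₀.a₃ = 1) ∧ (W₀.a₂ = -1 ∨ W₀.a₂ = 0 ∨ W₀.a₂ = 1) ∧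
      W₀.c₄ ≠ 0 ∧ W₀.c₆ ≠ 0 ∧ (((W₀.baseChange ℚ).conductorNorm ℤ : ℕ) : ℝ) ≤ X ∧
      (((W₀.baseChange ℚ).conductorNorm ℤ : ℕ) : ℝ) ^ κ ≤ ((max |W₀.Δ| (|W₀.c₄| ^ 3) : ℤ) : ℝ) ∧
      ((max |W₀.Δ| (|W₀.c₄| ^ 3) : ℤ) : ℝ) ≤ (((W₀.baseChange ℚ).conductorNorm ℤ : ℕ) : ℝ) ^ σ} →
      ((W.a₁, W.a₂, W.a₃), (W.c₄, W.c₆)) ∈ (↑T : Set (ℤ × ℤ × ℤ)) ×ˢ U := by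
    intro W hW
    obtain ⟨hE, hmin, h₁, h₃, h₂, hc₄, hc₆, hNX, hlo, hhi⟩ := hW
    refine Set.mk_mem_prod ?_ ?_
    · simp only [hT, Finset.coe_product, Finset.coe_insert, Finset.coe_singleton, Set.mem_prod,
        Set.mem_insert_iff, Set.mem_singleton_iff]
      exact ⟨h₁, h₂, h₃⟩
    · have hmem := mem_cuspShell_of_window hκ0 hmin hc₄ hc₆ hNX hlo
      have hjJ := log_Mcusp_le hσ0 hNX hhi
      rw [hU]
      simp only [Set.mem_iUnion, Finset.mem_range]
      exact ⟨Nat.log 2 (Mcusp (W.c₄, W.c₆)), Nat.lt_succ_of_le hjJ, hmem⟩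
  have h1 := Set.ncard_le_ncard_of_injOn (fun W : WeierstrassCurve ℤ => ((W.a₁, W.a₂, W.a₃), (W.c₄, W.c₆)))
    hmaps (model_injective.injOn) hfin
  have h2 : ((↑T : Set (ℤ × ℤ × ℤ)) ×ˢ U).ncard = 12 * U.ncard := by
    rw [Set.ncard_prod, Set.ncard_coe_finset, card_reducedTriples]
  have h3 : U.ncard ≤ ∑ j ∈ Finset.range (J + 1), (cuspShell (Xj j) ((2 : ℝ) ^ j)).ncard :=
    Finset.set_ncard_biUnion_le _ _
  -- Step 2: the per-shell bound
  have hXpow1 : 1 ≤ X ^ (1 - κ / 6) := Real.one_le_rpow hX (by linarith)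
  have hshell : ∀ j ∈ Finset.range (J + 1),
      ((cuspShell (Xj j) ((2 : ℝ) ^ j)).ncard : ℝ) ≤ 3 * C₀ * X ^ (ε / 2) * X ^ (1 - κ / 6) := by
    intro j hj
    have hjJ : j ≤ J := Nat.lt_succ_iff.mp (Finset.mem_range.mp hj)
    have hXj1 : 1 ≤ Xj j := le_min hX (Real.one_le_rpow (by norm_num) (by positivity))
    have hXjX : Xj j ≤ X := min_le_left _ _
    have hXj0 : 0 ≤ Xj j := by linarith
    have h2j1 : (1 : ℝ) ≤ (2 : ℝ) ^ j := one_le_pow₀ (by norm_num)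
    have h2jσ : (2 : ℝ) ^ j ≤ X ^ σ := by
      have hfl0 : ⌊X ^ σ⌋₊ ≠ 0 := by
        have : 1 ≤ ⌊X ^ σ⌋₊ := Nat.le_floor (by exact_mod_cast Real.one_le_rpow hX hσ0)
        omega
      have hA : ((2 ^ J : ℕ) : ℝ) ≤ (⌊X ^ σ⌋₊ : ℝ) := by exact_mod_cast Nat.pow_log_le_self 2 hfl0
      push_cast at hA
      calc (2 : ℝ) ^ j ≤ (2 : ℝ) ^ J := pow_le_pow_right₀ (by norm_num) hjJ
        _ ≤ ⌊X ^ σ⌋₊ := hA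
        _ ≤ X ^ σ := Nat.floor_le (by positivity)
    have hb := hC (Xj j) ((2 : ℝ) ^ j) hXj1 h2j1
    -- `(X_j 2^j)^{ε'} ≤ X^{ε/2}`
    have hloss : (Xj j * (2 : ℝ) ^ j) ^ (ε / (2 * (σ + 1))) ≤ X ^ (ε / 2) := by
      calc (Xj j * (2 : ℝ) ^ j) ^ (ε / (2 * (σ + 1))) ≤ (X * X ^ σ) ^ (ε / (2 * (σ + 1))) :=
            Real.rpow_le_rpow (by positivity) (mul_le_mul hXjX h2jσ (by positivity) hX0.le) hε'.le
        _ = X ^ (ε / 2) := by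
            rw [← Real.rpow_one_add' hX0.le (by positivity), ← Real.rpow_mul hX0.le]
            congr 1
            field_simp
            ring
    -- main term
    have hmain : Xj j * ((2 : ℝ) ^ j) ^ (-(1 / 6 : ℝ)) + 1 ≤ 3 * X ^ (1 - κ / 6) := by
      have := shell_main_le hκ0 hκ6.le hX j
      linarith
    have hnn : 0 ≤ (Xj j * (2 : ℝ) ^ j) ^ (ε / (2 * (σ + 1))) * (Xj j * ((2 : ℝ) ^ j) ^ (-(1 / 6 : ℝ)) + 1) :=
      by positivity
    calc ((cuspShell (Xj j) ((2 : ℝ) ^ j)).ncard : ℝ)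
        ≤ C * (Xj j * (2 : ℝ) ^ j) ^ (ε / (2 * (σ + 1))) * (Xj j * ((2 : ℝ) ^ j) ^ (-(1 / 6 : ℝ)) + 1) := hb
      _ ≤ C₀ * ((Xj j * (2 : ℝ) ^ j) ^ (ε / (2 * (σ + 1))) * (Xj j * ((2 : ℝ) ^ j) ^ (-(1 / 6 : ℝ)) + 1)) := by
          rw [mul_assoc]; exact mul_le_mul_of_nonneg_right (le_max_left _ _) hnn
      _ ≤ C₀ * (X ^ (ε / 2) * (3 * X ^ (1 - κ / 6))) := by
          apply mul_le_mul_of_nonneg_left _ hC₀0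
          exact mul_le_mul hloss hmain (by positivity) (by positivity)
      _ = 3 * C₀ * X ^ (ε / 2) * X ^ (1 - κ / 6) := by ring
  -- Step 3: assemble
  have hcount := card_shells_le hσ0 hε hX
  have hB0 : 0 ≤ 3 * C₀ * X ^ (ε / 2) * X ^ (1 - κ / 6) := by positivity
  calc (Set.ncard {W₀ : WeierstrassCurve ℤ | (W₀.baseChange ℚ).IsElliptic ∧
          (∀ v : IsDedekindDomain.HeightOneSpectrum ℤ, (W₀.baseChange ℚ).IsMinimalAt v) ∧
          (W₀.a₁ = 0 ∨ W₀.a₁ = 1) ∧ (W₀.a₃ = 0 ∨ W₀.a₃ = 1) ∧ (W₀.a₂ = -1 ∨ W₀.a₂ = 0 ∨ W₀.a₂ = 1) ∧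
          W₀.c₄ ≠ 0 ∧ W₀.c₆ ≠ 0 ∧ (((W₀.baseChange ℚ).conductorNorm ℤ : ℕ) : ℝ) ≤ X ∧
          (((W₀.baseChange ℚ).conductorNorm ℤ : ℕ) : ℝ) ^ κ ≤ ((max |W₀.Δ| (|W₀.c₄| ^ 3) : ℤ) : ℝ) ∧
          ((max |W₀.Δ| (|W₀.c₄| ^ 3) : ℤ) : ℝ) ≤ (((W₀.baseChange ℚ).conductorNorm ℤ : ℕ) : ℝ) ^ σ} : ℝ)
      ≤ (((↑T : Set (ℤ × ℤ × ℤ)) ×ˢ U).ncard : ℝ) := by exact_mod_cast h1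
    _ = 12 * (U.ncard : ℝ) := by rw [h2]; push_cast; ring
    _ ≤ 12 * ∑ j ∈ Finset.range (J + 1), ((cuspShell (Xj j) ((2 : ℝ) ^ j)).ncard : ℝ) := by
        have : (U.ncard : ℝ) ≤ ∑ j ∈ Finset.range (J + 1), ((cuspShell (Xj j) ((2 : ℝ) ^ j)).ncard : ℝ) := by
          exact_mod_cast h3
        linarith
    _ ≤ 12 * ∑ _j ∈ Finset.range (J + 1), 3 * C₀ * X ^ (ε / 2) * X ^ (1 - κ / 6) := by
        gcongr with j hj
        exact hshell j hj
    _ = 12 * (((J + 1 : ℕ) : ℝ) * (3 * C₀ * X ^ (ε / 2) * X ^ (1 - κ / 6))) := by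
        rw [Finset.sum_const, Finset.card_range, nsmul_eq_mul]
    _ ≤ 12 * (((2 * σ / (ε * Real.log 2) + 1) * X ^ (ε / 2)) * (3 * C₀ * X ^ (ε / 2) * X ^ (1 - κ / 6))) := by
        gcongr
    _ = 12 * (3 * C₀) * (2 * σ / (ε * Real.log 2) + 1) * (X ^ (ε / 2) * X ^ (ε / 2) * X ^ (1 - κ / 6)) := by
        ring
    _ = 12 * (3 * C₀) * (2 * σ / (ε * Real.log 2) + 1) * X ^ (1 - κ / 6 + ε) := by
        rw [← Real.rpow_add hX0, ← Real.rpow_add hX0]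
        congr 2
        ring

end Assembly




end Summit.ABC.ABC.Theorems.SharpModerateLaw

end
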